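import Literature.Analysis.FunctionSpaces.SobolevContinuousDerivatives
import Literature.Analysis.FunctionSpaces.SteinExtensionProofs
import HarnessLib

/-!
# `⋂ₖ W^{k,2}(Ω)` consists of functions smooth up to the boundary (bounded Lipschitz `Ω ⊂ ℝ³`)

Analysis/FunctionSpaces support file (all results proved, no definitions, no named facts). The
qualitative form of the Sobolev imbedding `W^{j+m,p}(Ω) → C^j(Ω̄)` on bounded Lipschitz domains
(R. A. Adams, *Sobolev Spaces* (1975), Thm 5.4 Part II Case C with Remark 5.5 (4): reduce to `ℝⁿ`
by an extension operator; Evans, *PDE*, §5.6.3 Thm 6 (ii) and the remark "if `u ∈ W^{k,p}(U)` for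
all `k`, then `u ∈ C^∞(Ū)`"), for `p = 2`, `n = 3`, assembled from the tree:

* `exists_contDiff_rep_of_memSobolevDomain_lipschitz` — `W^{m+2,2}(Ω)`-functions agree a.e. on `Ω`
  with globally `C^m` functions (the discharged Calderón–Stein extension `stein_extension_holds`,
  then `exists_contDiff_rep_of_memSobolevDomain` of `SobolevContinuousDerivatives`);
* `exists_contDiffOn_closure_of_forall_memSobolevDomain` — a function in `W^{k,2}(Ω)` for every
  `k` agrees a.e. on `Ω` with one continuous function which is `C^∞` on `closure Ω` (for every `m`
  it coincides on the closure with a global `C^m` function: the representatives for different `m`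
  are continuous and a.e. equal on the open set `Ω`, hence equal there —
  `Measure.eqOn_open_of_ae_eq` — and on the closure).

Used for the smoothness up to the wall of weak Neumann solutions on the period cell of the
periodic cylinder (`FluidPDE/PeriodicCylinderNeumann*`; the cell is convex, hence Lipschitz:
`isLipschitzDomain_cylinderCell`).

## Mathlib / tree search

Tree: `stein_extension_holds` (`SteinExtensionProofs`), `exists_contDiff_rep_of_memSobolevDomain`
(`SobolevContinuousDerivatives`); nothing of the form `ContDiffOn … (closure Ω)` from Sobolev data
(`lean search 'contDiffOn.*closure.*Sobolev|MemSobolevDomain.*contDiffOn'`). Mathlib: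
`Measure.eqOn_open_of_ae_eq`, `Set.EqOn.closure`, `contDiffOn_infty`.

## References

* R. A. Adams, *Sobolev Spaces*, Academic Press (1975), Thm 5.4 Part II, Remark 5.5 (4). [Adams1975]
* L. C. Evans, *Partial Differential Equations*, 2nd ed. (2010), §5.6.3 Thm 6 and the remark on
  `C^∞(Ū)`. [Evans2010]
-/

noncomputable section

open MeasureTheory Metric Set Filter Topology Module TopologicalSpace Function
open scoped ENNReal NNReal ContDiff

namespace Literature.Analysis.FunctionSpaces

variable {E' : Type*} [NormedAddCommGroup E'] [InnerProductSpace ℝ E'] [FiniteDimensional ℝ E']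
  [MeasurableSpace E'] [BorelSpace E'] {μ : Measure E'} [μ.IsAddHaarMeasure]
variable {F : Type*} [NormedAddCommGroup F] [NormedSpace ℝ F] [FiniteDimensional ℝ F]

/-- **`W^{m+2,2}(Ω) ⊂ C^m(Ω̄)` on bounded Lipschitz domains of `ℝ³`, representative form**: a
function with `MemSobolevDomain (m+2) 2 Ω` agrees a.e. on `Ω` with a globally `C^m` function
(Calderón–Stein extension `stein_extension_holds` to `W^{m+2,2}(ℝ³)`, then
`exists_contDiff_rep_of_memSobolevDomain`). [folklore] -/
theorem exists_contDiff_rep_of_memSobolevDomain_lipschitz (hE : finrank ℝ E' = 3) {Ω : Opens E'}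
    (hΩ : IsLipschitzDomain Ω) (hb : Bornology.IsBounded (Ω : Set E')) (m : ℕ) {f : E' → F}
    (hf : MemSobolevDomain (m + 2) 2 Ω μ f) :
    ∃ f' : E' → F, f =ᵐ[μ.restrict Ω] f' ∧ ContDiff ℝ m f' := by
  haveI : CompleteSpace F := FiniteDimensional.complete ℝ F
  obtain ⟨ext, C, -, -, hext⟩ := stein_extension_holds (E' := E') (F := F) hΩ hb (m + 2) 2 one_le_two μ
  obtain ⟨heq, hmem, -⟩ := hext f hf
  obtain ⟨f', hff', hf'c⟩ := exists_contDiff_rep_of_memSobolevDomain (μ := μ) hE m hmem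
  refine ⟨f', ?_, hf'c⟩
  have h1 : f =ᵐ[μ.restrict Ω] ext f :=
    ae_restrict_of_forall_mem Ω.isOpen.measurableSet fun x hx => (heq hx).symm
  exact h1.trans (ae_restrict_of_ae hff')

/-- **Functions in `⋂ₖ W^{k,2}(Ω)` are smooth up to the boundary** (bounded Lipschitz `Ω` in a
three-dimensional inner product space): there is one function, `C^∞` on the closure `Ω̄`
(`ContDiffOn ℝ ∞ · (closure Ω)`, indeed for every `m` equal on `Ω̄` to a globally `C^m`
function) and continuous everywhere, which agrees with `f` a.e. on `Ω`. The representatives of the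
previous theorem for different `m` are continuous and a.e. equal on the open set `Ω`, hence equal
on `Ω` (`Measure.eqOn_open_of_ae_eq`) and on its closure. [folklore] -/
theorem exists_contDiffOn_closure_of_forall_memSobolevDomain (hE : finrank ℝ E' = 3) {Ω : Opens E'}
    (hΩ : IsLipschitzDomain Ω) (hb : Bornology.IsBounded (Ω : Set E')) {f : E' → F}
    (hf : ∀ k, MemSobolevDomain k 2 Ω μ f) :
    ∃ f' : E' → F, f =ᵐ[μ.restrict Ω] f' ∧ Continuous f' ∧ ContDiffOn ℝ ∞ f' (closure Ω) ∧
      ∀ m : ℕ, ∃ g : E' → F, ContDiff ℝ m g ∧ EqOn f' g (closure Ω) := by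
  obtain ⟨f₀, hf₀, hf₀c⟩ := exists_contDiff_rep_of_memSobolevDomain_lipschitz (μ := μ) hE hΩ hb 0 (hf 2)
  have hcont : Continuous f₀ := hf₀c.continuous
  have hreps : ∀ m : ℕ, ∃ g : E' → F, ContDiff ℝ m g ∧ EqOn f₀ g (closure Ω) := fun m => by
    obtain ⟨g, hfg, hgc⟩ := exists_contDiff_rep_of_memSobolevDomain_lipschitz (μ := μ) hE hΩ hb m (hf (m + 2))
    refine ⟨g, hgc, ?_⟩
    have hae : f₀ =ᵐ[μ.restrict Ω] g := hf₀.symm.trans hfg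
    have hopen : EqOn f₀ g Ω :=
      Measure.eqOn_open_of_ae_eq hae Ω.isOpen hcont.continuousOn hgc.continuous.continuousOn
    exact hopen.closure hcont hgc.continuous
  refine ⟨f₀, hf₀, hcont, ?_, hreps⟩
  rw [contDiffOn_infty]
  intro n
  obtain ⟨g, hgc, hfg⟩ := hreps n
  exact hgc.contDiffOn.congr fun x hx => hfg hx

end Literature.Analysis.FunctionSpaces
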